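import Mathlib
import Summits.NavierStokesRegularity.NavierStokesRegularity.Theorems.FilamentSkeletonRssStadiumAnchorTube
import Summits.NavierStokesRegularity.NavierStokesRegularity.Theorems.FilamentSkeletonRssStadiumFrozenPolygon
import Summits.NavierStokesRegularity.NavierStokesRegularity.Theorems.FilamentSkeletonRssStadiumTentFreeze
import Summits.NavierStokesRegularity.NavierStokesRegularity.Theorems.FilamentSkeletonRssStadiumRealJunction

/-!
# Route `FilamentSkeletonRss` · cruxes `SkeletonJ1L` (stmt-NavierStokesRegularity-23296, registered stub `stub_tangentSkeletonL` ≡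
# `TangentSkeletonNearStraightL`, stmt-23320) · line `child_tangent_analytic_strip_L` (b0b56c52900dd90a), stub `stub_stripPropagation` —
# freeze step of `rcore`, CAPSTONE: NEAR EVERY ANCHOR THE OWN-TENT FIELD IS THE FROZEN-TENT FIELD, WHICH IS HOLOMORPHIC

The continued own-filament field of the quarter-width programme is `U z = ∫_{Iic (ℓ z)} g_z + Σ_{k<n} [V z k, V z (k+1)]_{f_z} + ∫_{Ioi (r z)} g_z`:
the kernel of target `z` (`f_z` on complex sources, `g_z` on real sources) over the TENT OF `z` (vertex map `V`, real end vertices `ℓ z`, `r z`,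
vertices 1-Lipschitz in the target).  `tent_eq_frozen_nhds`: if at the anchor `z₀` the polygon lies in the stadium with POINTWISE POSITIVITY
(the corner certificates), the end vertices have room `η` inside the real trace, `g_z` is integrable on the two outer half-lines and the two frozen
FEET are holomorphic near `z₀` (tails: `Theorems.StadiumFrozenRealPiece` + far majorants), then on a ball `B(z₀, δ)`:
(i) `U z = Φ₀ z`, the integral over the FROZEN tent of `z₀` (`Theorems.StadiumTentFreeze.tent_freeze`, with the tube hypotheses discharged by
`Theorems.StadiumAnchorTube.anchor_tube` segment by segment — `anchor_tube_polygon` — and the junctions by `Theorems.StadiumRealJunction`), and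
(ii) `Φ₀` is holomorphic on the ball (`Theorems.StadiumFrozenPolygon.frozenPolygon_nhds` + the feet).  With
`Theorems.StadiumSourceHolomorphic.differentiableOn_of_locally_eq` this is the holomorphy clause of `rcore` modulo the per-anchor certificate checks
(`tent_differentiableOn`).  The kernels enter through defining equations (`hf`, `hg`), as the stub's `u` does.
HONEST FRAMING: bookkeeping for a HYPOTHETICAL filament skeleton on the NEGATIVE side of a MODEL route; the stub `stub_stripPropagation` is NOT closed by
this file, `TangentSkeletonNearStraightL` / `SkeletonJ1L` stay OPEN; nothing here bears on Navier–Stokes regularity or blow-up.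
`--supports stmt-NavierStokesRegularity-23320` (≡ stub `stub_tangentSkeletonL` of 23296).
-/

set_option linter.dupNamespace false

noncomputable section

namespace Summit.NavierStokesRegularity.NavierStokesRegularity.Theorems.StadiumTentFreezeNhds

open Set Filter Topology Complex MeasureTheory Metric Finset
open scoped InnerProductSpace Matrix
open Summit.NavierStokesRegularity.NavierStokesRegularity.Theorems.StadiumAnchorTube
open Summit.NavierStokesRegularity.NavierStokesRegularity.Theorems.StadiumFrozenPolygon
open Summit.NavierStokesRegularity.NavierStokesRegularity.Theorems.StadiumTentFreeze
open Summit.NavierStokesRegularity.NavierStokesRegularity.Theorems.StadiumRealJunction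
open Summit.NavierStokesRegularity.NavierStokesRegularity.Theorems.StadiumPartnerPiece
open Summit.NavierStokesRegularity.NavierStokesRegularity.Theorems.StadiumSourceHolomorphic

/-- **One tube radius for the whole polygon of the anchor.**  `F`, `G` holomorphic on the stadium `S`, anchor `z₀ ∈ S`, polygon
`P 0 → ⋯ → P n` with segments in `S` and pointwise positivity at the anchor along each.  Then some `δ > 0` with `B(z₀, δ) ⊆ S` such that for
every target `z ∈ B(z₀, δ)` and every `k < n` the `δ`-discs about the points of `[P k, P (k+1)]` lie in the principal-branch source set `Ω_z`
(on which the kernel of target `z` is holomorphic in the source, `Theorems.StadiumAnchorTube.kernel_source_differentiableOn`). [folklore] -/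
theorem anchor_tube_polygon {hs L cc : ℝ} {F : ℂ → (Fin 3 → ℂ)}
    (hF : DifferentiableOn ℂ F {z : ℂ | |z.im| < hs ∧ |z.re - cc| < L + hs})
    {G : ℂ → ℂ} (hG : DifferentiableOn ℂ G {z : ℂ | |z.im| < hs ∧ |z.re - cc| < L + hs})
    {z₀ : ℂ} (hz₀ : z₀ ∈ {z : ℂ | |z.im| < hs ∧ |z.re - cc| < L + hs}) {κ : ℝ} (P : ℕ → ℂ) :
    ∀ n : ℕ,
      (∀ k < n, ∀ t ∈ Icc (0:ℝ) 1, P k + (t : ℂ) * (P (k+1) - P k) ∈ {z : ℂ | |z.im| < hs ∧ |z.re - cc| < L + hs}) →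
      (∀ k < n, ∀ t ∈ Icc (0:ℝ) 1,
        0 < ((∑ i, (F z₀ i - F (P k + (t : ℂ) * (P (k+1) - P k)) i) ^ 2) +
          (κ : ℂ) * G (P k + (t : ℂ) * (P (k+1) - P k))).re) →
      ∃ δ : ℝ, 0 < δ ∧ ball z₀ δ ⊆ {z : ℂ | |z.im| < hs ∧ |z.re - cc| < L + hs} ∧
        ∀ z ∈ ball z₀ δ, ∀ k < n, ∀ t ∈ Icc (0:ℝ) 1, ball (P k + (t : ℂ) * (P (k+1) - P k)) δ ⊆
          {ζ : ℂ | ζ ∈ {z : ℂ | |z.im| < hs ∧ |z.re - cc| < L + hs} ∧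
            0 < ((∑ i, (F z i - F ζ i) ^ 2) + (κ : ℂ) * G ζ).re} := by
  intro n
  induction n with
  | zero =>
    intro _ _
    obtain ⟨ε, hε, hεS⟩ := Metric.isOpen_iff.mp (isOpen_stadium hs (L + hs) cc) z₀ hz₀
    exact ⟨ε, hε, hεS, fun z _ k hk => absurd hk (Nat.not_lt_zero k)⟩
  | succ n ih =>
    intro hseg hpos
    obtain ⟨δ₁, hδ₁, hball₁, htube₁⟩ :=
      ih (fun k hk => hseg k (Nat.lt_succ_of_lt hk)) (fun k hk => hpos k (Nat.lt_succ_of_lt hk))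
    obtain ⟨m, δ₂, -, hδ₂, hball₂, htube₂⟩ :=
      anchor_tube hF hG hz₀ (hseg n (Nat.lt_succ_self n)) (hpos n (Nat.lt_succ_self n))
    refine ⟨min δ₁ δ₂, lt_min hδ₁ hδ₂, (ball_subset_ball (min_le_left _ _)).trans hball₁, ?_⟩
    intro z hz k hk t ht
    rcases Nat.lt_succ_iff_lt_or_eq.mp hk with hk' | rfl
    · exact (ball_subset_ball (min_le_left _ _)).trans
        (htube₁ z (ball_subset_ball (min_le_left _ _) hz) k hk' t ht)
    · exact (ball_subset_ball (min_le_right _ _)).trans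
        ((htube₂ z (ball_subset_ball (min_le_right _ _) hz)).2.1 t ht)

/-- **Near every anchor the own-tent field equals the frozen-tent field, which is holomorphic.**  See the module docstring for the setting.
Hypotheses: stadium data (`F`, `G` holomorphic on `S`, `‖F′‖ ≤ M`, real traces `X` and `A`); the kernels `f` (complex sources) and `g` (real
sources) by their defining equations; the tent vertex map `V` with real end vertices `ℓ`, `r` and 1-Lipschitz vertices; at the anchor `z₀ ∈ S`:
segments in `S`, pointwise positivity, room `η` for the end vertices inside the real trace, integrability of `g_z` on `Iic (ℓ z₀ + η)` and
`Ioi (r z₀ − η)` and holomorphy of the two frozen feet for `z ∈ B(z₀, η)`.  Conclusion: a ball `B(z₀, δ) ⊆ S` on which the frozen-tent field is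
holomorphic and agrees with the own-tent field. [folklore] -/
theorem tent_eq_frozen_nhds {hs L cc M : ℝ} {F : ℂ → (Fin 3 → ℂ)}
    (hF : DifferentiableOn ℂ F {z : ℂ | |z.im| < hs ∧ |z.re - cc| < L + hs})
    (hM : ∀ z ∈ {z : ℂ | |z.im| < hs ∧ |z.re - cc| < L + hs}, ‖deriv F z‖ ≤ M) (hM0 : 0 ≤ M)
    {G : ℂ → ℂ} (hG : DifferentiableOn ℂ G {z : ℂ | |z.im| < hs ∧ |z.re - cc| < L + hs})
    {X : ℝ → EuclideanSpace ℝ (Fin 3)} (hX : Differentiable ℝ X)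
    (hFX : ∀ r : ℝ, (r : ℂ) ∈ {z : ℂ | |z.im| < hs ∧ |z.re - cc| < L + hs} →
      F r = fun i => ((⟪X r, EuclideanSpace.single i (1:ℝ)⟫_ℝ : ℝ) : ℂ))
    {A : ℝ → ℝ} (hGX : ∀ r : ℝ, (r : ℂ) ∈ {z : ℂ | |z.im| < hs ∧ |z.re - cc| < L + hs} → G r = ((A r : ℝ) : ℂ))
    (hhs : 0 < hs) {κ : ℝ}
    {f : ℂ → ℂ → (Fin 3 → ℂ)}
    (hf : ∀ z ζ, f z ζ = (((∑ i, (F z i - F ζ i) ^ 2) + (κ : ℂ) * G ζ) ^ ((3:ℂ) / 2))⁻¹ •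
      (deriv F ζ ⨯₃ (fun i => F z i - F ζ i)))
    {g : ℂ → ℝ → (Fin 3 → ℂ)}
    (hg : ∀ z σ, g z σ = (((∑ i, (F z i - ((X σ i : ℝ) : ℂ)) ^ 2) + ((κ * A σ : ℝ) : ℂ)) ^ ((3:ℂ) / 2))⁻¹ •
      ((fun i => ((deriv X σ i : ℝ) : ℂ)) ⨯₃ (fun i => F z i - ((X σ i : ℝ) : ℂ))))
    {V : ℂ → ℕ → ℂ} {n : ℕ} {ℓ r : ℂ → ℝ} (hV0 : ∀ z, V z 0 = (ℓ z : ℂ)) (hVn : ∀ z, V z n = (r z : ℂ))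
    (hVlip : ∀ z w, ∀ k ≤ n, dist (V z k) (V w k) ≤ dist z w)
    {z₀ : ℂ} (hz₀ : z₀ ∈ {z : ℂ | |z.im| < hs ∧ |z.re - cc| < L + hs})
    (hseg : ∀ k < n, ∀ t ∈ Icc (0:ℝ) 1,
      V z₀ k + (t : ℂ) * (V z₀ (k+1) - V z₀ k) ∈ {z : ℂ | |z.im| < hs ∧ |z.re - cc| < L + hs})
    (hpos : ∀ k < n, ∀ t ∈ Icc (0:ℝ) 1,
      0 < ((∑ i, (F z₀ i - F (V z₀ k + (t : ℂ) * (V z₀ (k+1) - V z₀ k)) i) ^ 2) +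
        (κ : ℂ) * G (V z₀ k + (t : ℂ) * (V z₀ (k+1) - V z₀ k))).re)
    {η : ℝ} (hη : 0 < η)
    (hℓrange : ∀ σ : ℝ, |σ - ℓ z₀| < η → |σ - cc| < L + hs) (hrrange : ∀ σ : ℝ, |σ - r z₀| < η → |σ - cc| < L + hs)
    (hint : ∀ z ∈ ball z₀ η, IntegrableOn (g z) (Iic (ℓ z₀ + η)) ∧ IntegrableOn (g z) (Ioi (r z₀ - η)))
    (hfeet : DifferentiableOn ℂ (fun z => ∫ σ in Iic (ℓ z₀), g z σ) (ball z₀ η) ∧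
      DifferentiableOn ℂ (fun z => ∫ σ in Ioi (r z₀), g z σ) (ball z₀ η)) :
    ∃ δ : ℝ, 0 < δ ∧ ball z₀ δ ⊆ {z : ℂ | |z.im| < hs ∧ |z.re - cc| < L + hs} ∧
      DifferentiableOn ℂ (fun z => (∫ σ in Iic (ℓ z₀), g z σ) +
        (∑ k ∈ range n, ∫ t in (0:ℝ)..1, (V z₀ (k+1) - V z₀ k) • f z (V z₀ k + (t : ℂ) * (V z₀ (k+1) - V z₀ k))) +
        ∫ σ in Ioi (r z₀), g z σ) (ball z₀ δ) ∧
      ∀ z ∈ ball z₀ δ,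
        (∫ σ in Iic (ℓ z), g z σ) +
            (∑ k ∈ range n, ∫ t in (0:ℝ)..1, (V z (k+1) - V z k) • f z (V z k + (t : ℂ) * (V z (k+1) - V z k))) +
            (∫ σ in Ioi (r z), g z σ) =
          (∫ σ in Iic (ℓ z₀), g z σ) +
            (∑ k ∈ range n, ∫ t in (0:ℝ)..1, (V z₀ (k+1) - V z₀ k) • f z (V z₀ k + (t : ℂ) * (V z₀ (k+1) - V z₀ k))) +
            ∫ σ in Ioi (r z₀), g z σ := by
  set S : Set ℂ := {z : ℂ | |z.im| < hs ∧ |z.re - cc| < L + hs} with hS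
  have hfz : ∀ z, f z = fun ζ => (((∑ i, (F z i - F ζ i) ^ 2) + (κ : ℂ) * G ζ) ^ ((3:ℂ) / 2))⁻¹ •
      (deriv F ζ ⨯₃ (fun i => F z i - F ζ i)) := fun z => funext (hf z)
  have hgz : ∀ z, g z = fun σ => (((∑ i, (F z i - ((X σ i : ℝ) : ℂ)) ^ 2) + ((κ * A σ : ℝ) : ℂ)) ^ ((3:ℂ) / 2))⁻¹ •
      ((fun i => ((deriv X σ i : ℝ) : ℂ)) ⨯₃ (fun i => F z i - ((X σ i : ℝ) : ℂ))) := fun z => funext (hg z)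
  -- (a) one tube radius for the anchor's polygon
  obtain ⟨δT, hδT, hballT, htubeT⟩ := anchor_tube_polygon hF hG hz₀ (κ := κ) (V z₀) n hseg hpos
  -- (b) the frozen polygon is holomorphic near the anchor
  obtain ⟨δP, C, hδP, hballP, hdiffP, -⟩ := frozenPolygon_nhds hF hM hM0 hG.continuousOn hz₀ (κ := κ) (V z₀) n hseg hpos
  -- the radius
  set δ : ℝ := min (min (δT / 2) δP) η with hδdef
  have hδpos : 0 < δ := lt_min (lt_min (half_pos hδT) hδP) hη
  have hδT2 : δ ≤ δT / 2 := (min_le_left _ _).trans (min_le_left _ _)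
  have hδT' : δ ≤ δT := hδT2.trans (half_le_self hδT.le)
  have hδP' : δ ≤ δP := (min_le_left _ _).trans (min_le_right _ _)
  have hδη : δ ≤ η := min_le_right _ _
  have hballS : ball z₀ δ ⊆ S := (ball_subset_ball hδP').trans hballP
  refine ⟨δ, hδpos, hballS, ?_, ?_⟩
  · -- holomorphy of the frozen tent
    have h1 := (hfeet.1.mono (ball_subset_ball hδη))
    have h2 := (hfeet.2.mono (ball_subset_ball hδη))
    have h3 : DifferentiableOn ℂ (fun z => ∑ k ∈ range n, ∫ t in (0:ℝ)..1, (V z₀ (k+1) - V z₀ k) •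
        f z (V z₀ k + (t : ℂ) * (V z₀ (k+1) - V z₀ k))) (ball z₀ δ) := by
      refine (hdiffP.mono (ball_subset_ball hδP')).congr fun z _ => ?_
      simp only [hf]
    exact (h1.add h3).add h2
  · -- the freeze identity
    intro z hz
    have hzT : z ∈ ball z₀ δT := ball_subset_ball hδT' hz
    have hzη : z ∈ ball z₀ η := ball_subset_ball hδη hz
    have hdist : dist z z₀ < δ := mem_ball.mp hz
    -- closeness of the vertices
    have hclose : ∀ k ≤ n, dist (V z k) (V z₀ k) < δT / 2 := fun k hk =>
      lt_of_le_of_lt (hVlip z z₀ k hk) (lt_of_lt_of_le hdist hδT2)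
    -- the end vertices move by less than `δ ≤ η`
    have hℓ : |ℓ z - ℓ z₀| < δ := by
      have h := hVlip z z₀ 0 (Nat.zero_le n)
      rw [hV0, hV0, dist_eq_norm, ← Complex.ofReal_sub, Complex.norm_real, Real.norm_eq_abs] at h
      exact lt_of_le_of_lt h hdist
    have hr : |r z - r z₀| < δ := by
      have h := hVlip z z₀ n le_rfl
      rw [hVn, hVn, dist_eq_norm, ← Complex.ofReal_sub, Complex.norm_real, Real.norm_eq_abs] at h
      exact lt_of_le_of_lt h hdist
    -- junctions inside the real trace
    have hJLrange : ∀ σ ∈ uIcc (ℓ z₀) (ℓ z), |σ - cc| < L + hs := by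
      intro σ hσ
      apply hℓrange
      rcases mem_uIcc.mp hσ with ⟨h1, h2⟩ | ⟨h1, h2⟩
      · rw [abs_lt] at hℓ ⊢; constructor <;> linarith
      · rw [abs_lt] at hℓ ⊢; constructor <;> linarith
    have hJRrange : ∀ σ ∈ uIcc (r z₀) (r z), |σ - cc| < L + hs := by
      intro σ hσ
      apply hrrange
      rcases mem_uIcc.mp hσ with ⟨h1, h2⟩ | ⟨h1, h2⟩
      · rw [abs_lt] at hr ⊢; constructor <;> linarith
      · rw [abs_lt] at hr ⊢; constructor <;> linarith
    have hJL := real_junction_eq hF hX hFX hGX hhs κ z hJLrange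
    have hJR := real_junction_eq hF hX hFX hGX hhs κ z hJRrange
    -- integrability on the four half-lines
    obtain ⟨hiL, hiR⟩ := hint z hzη
    have hgL₀ : IntegrableOn (g z) (Iic (ℓ z₀)) := hiL.mono_set (Iic_subset_Iic.mpr (by linarith))
    have hgL : IntegrableOn (g z) (Iic (ℓ z)) :=
      hiL.mono_set (Iic_subset_Iic.mpr (by rw [abs_lt] at hℓ; linarith))
    have hgR₀ : IntegrableOn (g z) (Ioi (r z₀)) := hiR.mono_set (Ioi_subset_Ioi (by linarith))
    have hgR : IntegrableOn (g z) (Ioi (r z)) :=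
      hiR.mono_set (Ioi_subset_Ioi (by rw [abs_lt] at hr; linarith))
    -- the tent freeze identity
    have key := tent_freeze (kernel_source_differentiableOn hF hG z κ) (V z₀) (V z) hδT n (htubeT z hzT) hclose
      (hV0 z₀) (hV0 z) (hVn z₀) (hVn z) (g := g z)
      (by rw [hgz z]; simpa [hfz z] using hJL) (by rw [hgz z]; simpa [hfz z] using hJR) hgL₀ hgL hgR₀ hgR
    simpa [hfz z] using key

/-- **Sharper form of `tent_eq_frozen_nhds`** (same statement and proof, with the integrability hypothesis EXACTLY as the tent freeze consumes it:
`g_z` integrable on `Iic (ℓ z₀)`, `Iic (ℓ z)`, `Ioi (r z₀)`, `Ioi (r z)` for the targets `z` of the ball — no sliver beyond the feet of the anchor and of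
the target, where no corner certificate is available).  The frozen feet `Ioi (r z₀)` / `Iic (ℓ z₀)` are certified at the anchor and persist on a ball
(`Theorems.StadiumFrozenRealPiece` + tails), the own feet `Ioi (r z)` / `Iic (ℓ z)` are certified at the target itself. [folklore] -/
theorem tent_eq_frozen_nhds_sharp {hs L cc M : ℝ} {F : ℂ → (Fin 3 → ℂ)}
    (hF : DifferentiableOn ℂ F {z : ℂ | |z.im| < hs ∧ |z.re - cc| < L + hs})
    (hM : ∀ z ∈ {z : ℂ | |z.im| < hs ∧ |z.re - cc| < L + hs}, ‖deriv F z‖ ≤ M) (hM0 : 0 ≤ M)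
    {G : ℂ → ℂ} (hG : DifferentiableOn ℂ G {z : ℂ | |z.im| < hs ∧ |z.re - cc| < L + hs})
    {X : ℝ → EuclideanSpace ℝ (Fin 3)} (hX : Differentiable ℝ X)
    (hFX : ∀ r : ℝ, (r : ℂ) ∈ {z : ℂ | |z.im| < hs ∧ |z.re - cc| < L + hs} →
      F r = fun i => ((⟪X r, EuclideanSpace.single i (1:ℝ)⟫_ℝ : ℝ) : ℂ))
    {A : ℝ → ℝ} (hGX : ∀ r : ℝ, (r : ℂ) ∈ {z : ℂ | |z.im| < hs ∧ |z.re - cc| < L + hs} → G r = ((A r : ℝ) : ℂ))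
    (hhs : 0 < hs) {κ : ℝ}
    {f : ℂ → ℂ → (Fin 3 → ℂ)}
    (hf : ∀ z ζ, f z ζ = (((∑ i, (F z i - F ζ i) ^ 2) + (κ : ℂ) * G ζ) ^ ((3:ℂ) / 2))⁻¹ •
      (deriv F ζ ⨯₃ (fun i => F z i - F ζ i)))
    {g : ℂ → ℝ → (Fin 3 → ℂ)}
    (hg : ∀ z σ, g z σ = (((∑ i, (F z i - ((X σ i : ℝ) : ℂ)) ^ 2) + ((κ * A σ : ℝ) : ℂ)) ^ ((3:ℂ) / 2))⁻¹ •
      ((fun i => ((deriv X σ i : ℝ) : ℂ)) ⨯₃ (fun i => F z i - ((X σ i : ℝ) : ℂ))))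
    {V : ℂ → ℕ → ℂ} {n : ℕ} {ℓ r : ℂ → ℝ} (hV0 : ∀ z, V z 0 = (ℓ z : ℂ)) (hVn : ∀ z, V z n = (r z : ℂ))
    (hVlip : ∀ z w, ∀ k ≤ n, dist (V z k) (V w k) ≤ dist z w)
    {z₀ : ℂ} (hz₀ : z₀ ∈ {z : ℂ | |z.im| < hs ∧ |z.re - cc| < L + hs})
    (hseg : ∀ k < n, ∀ t ∈ Icc (0:ℝ) 1,
      V z₀ k + (t : ℂ) * (V z₀ (k+1) - V z₀ k) ∈ {z : ℂ | |z.im| < hs ∧ |z.re - cc| < L + hs})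
    (hpos : ∀ k < n, ∀ t ∈ Icc (0:ℝ) 1,
      0 < ((∑ i, (F z₀ i - F (V z₀ k + (t : ℂ) * (V z₀ (k+1) - V z₀ k)) i) ^ 2) +
        (κ : ℂ) * G (V z₀ k + (t : ℂ) * (V z₀ (k+1) - V z₀ k))).re)
    {η : ℝ} (hη : 0 < η)
    (hℓrange : ∀ σ : ℝ, |σ - ℓ z₀| < η → |σ - cc| < L + hs) (hrrange : ∀ σ : ℝ, |σ - r z₀| < η → |σ - cc| < L + hs)
    (hint : ∀ z ∈ ball z₀ η, IntegrableOn (g z) (Iic (ℓ z₀)) ∧ IntegrableOn (g z) (Iic (ℓ z)) ∧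
      IntegrableOn (g z) (Ioi (r z₀)) ∧ IntegrableOn (g z) (Ioi (r z)))
    (hfeet : DifferentiableOn ℂ (fun z => ∫ σ in Iic (ℓ z₀), g z σ) (ball z₀ η) ∧
      DifferentiableOn ℂ (fun z => ∫ σ in Ioi (r z₀), g z σ) (ball z₀ η)) :
    ∃ δ : ℝ, 0 < δ ∧ ball z₀ δ ⊆ {z : ℂ | |z.im| < hs ∧ |z.re - cc| < L + hs} ∧
      DifferentiableOn ℂ (fun z => (∫ σ in Iic (ℓ z₀), g z σ) +
        (∑ k ∈ range n, ∫ t in (0:ℝ)..1, (V z₀ (k+1) - V z₀ k) • f z (V z₀ k + (t : ℂ) * (V z₀ (k+1) - V z₀ k))) +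
        ∫ σ in Ioi (r z₀), g z σ) (ball z₀ δ) ∧
      ∀ z ∈ ball z₀ δ,
        (∫ σ in Iic (ℓ z), g z σ) +
            (∑ k ∈ range n, ∫ t in (0:ℝ)..1, (V z (k+1) - V z k) • f z (V z k + (t : ℂ) * (V z (k+1) - V z k))) +
            (∫ σ in Ioi (r z), g z σ) =
          (∫ σ in Iic (ℓ z₀), g z σ) +
            (∑ k ∈ range n, ∫ t in (0:ℝ)..1, (V z₀ (k+1) - V z₀ k) • f z (V z₀ k + (t : ℂ) * (V z₀ (k+1) - V z₀ k))) +
            ∫ σ in Ioi (r z₀), g z σ := by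
  set S : Set ℂ := {z : ℂ | |z.im| < hs ∧ |z.re - cc| < L + hs} with hS
  have hfz : ∀ z, f z = fun ζ => (((∑ i, (F z i - F ζ i) ^ 2) + (κ : ℂ) * G ζ) ^ ((3:ℂ) / 2))⁻¹ •
      (deriv F ζ ⨯₃ (fun i => F z i - F ζ i)) := fun z => funext (hf z)
  have hgz : ∀ z, g z = fun σ => (((∑ i, (F z i - ((X σ i : ℝ) : ℂ)) ^ 2) + ((κ * A σ : ℝ) : ℂ)) ^ ((3:ℂ) / 2))⁻¹ •
      ((fun i => ((deriv X σ i : ℝ) : ℂ)) ⨯₃ (fun i => F z i - ((X σ i : ℝ) : ℂ))) := fun z => funext (hg z)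
  -- (a) one tube radius for the anchor's polygon
  obtain ⟨δT, hδT, hballT, htubeT⟩ := anchor_tube_polygon hF hG hz₀ (κ := κ) (V z₀) n hseg hpos
  -- (b) the frozen polygon is holomorphic near the anchor
  obtain ⟨δP, C, hδP, hballP, hdiffP, -⟩ := frozenPolygon_nhds hF hM hM0 hG.continuousOn hz₀ (κ := κ) (V z₀) n hseg hpos
  -- the radius
  set δ : ℝ := min (min (δT / 2) δP) η with hδdef
  have hδpos : 0 < δ := lt_min (lt_min (half_pos hδT) hδP) hη
  have hδT2 : δ ≤ δT / 2 := (min_le_left _ _).trans (min_le_left _ _)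
  have hδT' : δ ≤ δT := hδT2.trans (half_le_self hδT.le)
  have hδP' : δ ≤ δP := (min_le_left _ _).trans (min_le_right _ _)
  have hδη : δ ≤ η := min_le_right _ _
  have hballS : ball z₀ δ ⊆ S := (ball_subset_ball hδP').trans hballP
  refine ⟨δ, hδpos, hballS, ?_, ?_⟩
  · -- holomorphy of the frozen tent
    have h1 := (hfeet.1.mono (ball_subset_ball hδη))
    have h2 := (hfeet.2.mono (ball_subset_ball hδη))
    have h3 : DifferentiableOn ℂ (fun z => ∑ k ∈ range n, ∫ t in (0:ℝ)..1, (V z₀ (k+1) - V z₀ k) •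
        f z (V z₀ k + (t : ℂ) * (V z₀ (k+1) - V z₀ k))) (ball z₀ δ) := by
      refine (hdiffP.mono (ball_subset_ball hδP')).congr fun z _ => ?_
      simp only [hf]
    exact (h1.add h3).add h2
  · -- the freeze identity
    intro z hz
    have hzT : z ∈ ball z₀ δT := ball_subset_ball hδT' hz
    have hzη : z ∈ ball z₀ η := ball_subset_ball hδη hz
    have hdist : dist z z₀ < δ := mem_ball.mp hz
    -- closeness of the vertices
    have hclose : ∀ k ≤ n, dist (V z k) (V z₀ k) < δT / 2 := fun k hk =>
      lt_of_le_of_lt (hVlip z z₀ k hk) (lt_of_lt_of_le hdist hδT2)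
    -- the end vertices move by less than `δ ≤ η`
    have hℓ : |ℓ z - ℓ z₀| < δ := by
      have h := hVlip z z₀ 0 (Nat.zero_le n)
      rw [hV0, hV0, dist_eq_norm, ← Complex.ofReal_sub, Complex.norm_real, Real.norm_eq_abs] at h
      exact lt_of_le_of_lt h hdist
    have hr : |r z - r z₀| < δ := by
      have h := hVlip z z₀ n le_rfl
      rw [hVn, hVn, dist_eq_norm, ← Complex.ofReal_sub, Complex.norm_real, Real.norm_eq_abs] at h
      exact lt_of_le_of_lt h hdist
    -- junctions inside the real trace
    have hJLrange : ∀ σ ∈ uIcc (ℓ z₀) (ℓ z), |σ - cc| < L + hs := by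
      intro σ hσ
      apply hℓrange
      rcases mem_uIcc.mp hσ with ⟨h1, h2⟩ | ⟨h1, h2⟩
      · rw [abs_lt] at hℓ ⊢; constructor <;> linarith
      · rw [abs_lt] at hℓ ⊢; constructor <;> linarith
    have hJRrange : ∀ σ ∈ uIcc (r z₀) (r z), |σ - cc| < L + hs := by
      intro σ hσ
      apply hrrange
      rcases mem_uIcc.mp hσ with ⟨h1, h2⟩ | ⟨h1, h2⟩
      · rw [abs_lt] at hr ⊢; constructor <;> linarith
      · rw [abs_lt] at hr ⊢; constructor <;> linarith
    have hJL := real_junction_eq hF hX hFX hGX hhs κ z hJLrange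
    have hJR := real_junction_eq hF hX hFX hGX hhs κ z hJRrange
    -- integrability on the four half-lines
    obtain ⟨hgL₀, hgL, hgR₀, hgR⟩ := hint z hzη
    -- the tent freeze identity
    have key := tent_freeze (kernel_source_differentiableOn hF hG z κ) (V z₀) (V z) hδT n (htubeT z hzT) hclose
      (hV0 z₀) (hV0 z) (hVn z₀) (hVn z) (g := g z)
      (by rw [hgz z]; simpa [hfz z] using hJL) (by rw [hgz z]; simpa [hfz z] using hJR) hgL₀ hgL hgR₀ hgR
    simpa [hfz z] using key


end Summit.NavierStokesRegularity.NavierStokesRegularity.Theorems.StadiumTentFreezeNhds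

end
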